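import Literature.NumberTheory.Rogawski1990.AdelicStableClassesProductH
import Literature.Topology.Algebra.RestrictedProduct.FinsumProdReindex
import HarnessLib

/-!
# `Σ_{𝒞′_𝐀(γ_H)} Φ_H(δ, f^H) = Φ^st_{H,∞} · ∏_{v ∈ S} Φ^st_{H,v}` — the `H`-adelic stable orbital sum is EULER whenever its summand factors through the local and
# archimedean classes with unit factors almost everywhere (Rogawski (1990), §4.3 p. 44: «we may therefore set `Φ^κ(γ, f) = Π_v Φ^{κ_v}(γ, f_v)`»; §5.4 (5.4.3)
# pp. 72–73; Kottwitz (1986) Prop. 7.1)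

Topic `NumberTheory/Rogawski1990`; namespace `Literature.NumberTheory.Rogawski1990`; THEOREMS ONLY (no definition, no instance, no named fact, no `sorry`).  Cell
`pub/hodgecm-mathlib`, ENGINE T1, ED 1.19c (xiii″) — the `H = U(Φ₂) × U(Φ₁)`-side Euler discharge (E3-H₀), GENERIC IN THE ADELIC `H`-FAMILY: ★ (E1)
`Literature.Topology.Algebra.RestrictedProduct.finsum_mem_eq_finsum_mul_prod_finsum_of_factor` instantiated on the dictionary ★ (E2-H) `AdelicStableClassesProductH`
((img) `MatchingAdeleH.isLocalStablyConjH_out_map_toLocal` ∕ `…isArchStablyConjH_out_map_arch`, (ev) `MatchingAdeleH.eventually_map_toLocal_eq_mk`, (inj)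
`MatchingAdeleH.eq_of_forall_map_toLocal_eq_of_map_arch_eq`, (surj) `MatchingAdeleH.exists_mem_classes_of_forall`) for the class set `𝒞′_𝐀(γ_H) = adelicStableClassesOverH L γH`
(★ typer brick `AdelicStableOrbitalIntegral` §3.2) over a rational `γ_H = (γ₂, γ₁)`, base classes `e_v = [(γ_H)_v]`, `e_∞`-free archimedean factor:

* §1 **`eq_mk_rationalComponent_of_isLocalStablyConjH_of_mem`** ∕ **`…_of_exists_mem`** — at a good place `v` of [Kt₄] Prop. 7.1 for `U(Φ₂)` at `γ₂` (hypothesis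
  `hPv`, the place-`v` body of ★ `AdelicStableOrbitalSupportFiniteH`'s `hP`), an element ∕ class of `H_v` stably conjugate to `(γ_H)_v` whose `U(Φ₂)`-coordinate lies in
  `K₂,v` IS (the class of) `(γ_H)_v` — the `U(Φ₁)`-coordinate being rigid (★ `eq_of_isStablyConj_fin_one`).  This is the (h0) input «off `S` only the base class meets
  `K_{H,v}`» of (E1).
* §2 **`MatchingAdeleH.finsum_mem_classes_eq_finsum_mul_prod_finsum`** — for ANY summand `Φ : ConjClasses H(𝐀) → ℂ` which FACTORS on `𝒞′_𝐀(γ_H)` as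
  `Φ c = φ_∞ (π_∞ c) · ∏ᶠ_v φ_v (π_v c)` through the class maps, with `φ_v [(γ_H)_v] = 1` and `φ_v` vanishing at the stable classes not met by `K₂,v × H₁,v` off a finite
  `S` containing the bad places of `hP` (hypothesis `hPS`: the `hP` body at every `v ∉ S`), and finite supports on the stable classes at `v ∈ S` and at `∞`:
  `∑ᶠ c ∈ 𝒞′_𝐀(γ_H), Φ c = (∑ᶠ b ∈ St_∞, φ_∞ b) · ∏_{v ∈ S} ∑ᶠ d ∈ St_v, φ_v d`.
* §3 **`MatchingAdeleH.isEulerOnClasses_of_factor`** — the same for `Φ := classOrbitalIntegral m_𝐀 f^H` (any adelic `H`-family `m_𝐀`, any `f^H`): ★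
  `IsEulerOnClasses (adelicStableClassesOverH L γH) m_𝐀 f^H S (fun v => ∑ᶠ d ∈ St_v, φ_v d) (∑ᶠ b ∈ St_∞, φ_∞ b)`, and `adelicStableOrbitalIntegralH L γH m_𝐀 f^H` in closed form.

What is NOT here (no ★ brick yet, flagged on the cell bus 04:45Z): the FACTORISATION (hfac) of `Φ_{m_𝐀}(c, ⊗_v f^H_v)` for an adelic `H`-family built from local
`H`-families («C-H», F0-typ1 GO #78) and the UNIT FACTORS (h1) `Φ_{H,v}((γ_H)_v, 1_{K_{H,v}}) = 1` a.e. («S-H», F0P3a-p06); both enter here as hypotheses, in the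
shapes those bricks will discharge.  HC_CM is proved only modulo the printed citations until rung 0 closes; this file is unconditional.

## References
* J. D. Rogawski, *Automorphic Representations of Unitary Groups in Three Variables*, Ann. of Math. Stud. 123 (1990), §4.3 p. 44, §5.4 (5.4.3) pp. 72–73
  [Rogawski1990].
* R. E. Kottwitz, *Stable trace formula: elliptic singular terms*, Math. Ann. 275 (1986), Prop. 7.1, §7.3 [Kottwitz1986].
-/

noncomputable section

open NumberField IsDedekindDomain Filter Function
open scoped MatrixGroups

namespace Literature.NumberTheory.Rogawski1990

open Literature.NumberTheory.Automorphic
open Literature.AlgebraicGeometry.ShimuraVarieties (unitaryGroup)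
open Literature.Topology.Algebra.RestrictedProduct (finsum_mem_eq_finsum_mul_prod_finsum_of_factor)

section EulerH

variable {L : Type} [Field L] [NumberField L] [IsCMField L]
variable {γH : (UnitaryGroup.cmDatum L 2 (Matrix.of fun i j : Fin 2 => if i.val + j.val + 1 = 2 then (1 : L) else 0)).Rational ×
  (UnitaryGroup.cmDatum L 1 (Matrix.of fun i j : Fin 1 => if i.val + j.val + 1 = 1 then (1 : L) else 0)).Rational}

/-- `[out c] = c` (plumbing). [cite: Rogawski1990, §5.4 p. 72] -/
private theorem conjClasses_mk_out_eq'' {A : Type*} [Monoid A] (c : ConjClasses A) : ConjClasses.mk (Quotient.out c) = c := by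
  rw [← ConjClasses.quotient_mk_eq_mk, Quotient.out_eq]

/-- `x ∼ out [x]` (plumbing). [cite: Rogawski1990, §5.4 p. 72] -/
private theorem isConj_out_conjClasses_mk'' {A : Type*} [Monoid A] (x : A) : IsConj x (Quotient.out (ConjClasses.mk x)) :=
  ConjClasses.mk_eq_mk_iff_isConj.1 (conjClasses_mk_out_eq'' _).symm

/-- Conjugacy in a product of groups from conjugacy in the first factor and equality in the second (plumbing). [cite: Rogawski1990, §3.1 p. 19] -/
private theorem isConj_prod_of_isConj_of_eq' {M N : Type*} [Group M] [Group N] {a b : M} {x y : N} (h : IsConj a b) (hxy : x = y) :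
    IsConj (a, x) (b, y) := by
  subst hxy
  obtain ⟨c, hc⟩ := isConj_iff.1 h
  refine isConj_iff.2 ⟨(c, 1), ?_⟩
  rw [← hc]
  ext <;> simp

/-! ## §1 At a good place, a stably conjugate element ∕ class with integral `U(Φ₂)`-coordinate IS the base point ∕ class -/

/-- **At a good place of [Kt₄] Prop. 7.1, an element of `H_v = U(Φ₂)_v × U(Φ₁)_v` stably conjugate to `(γ_H)_v` with `U(Φ₂)`-coordinate in `K₂,v` is CONJUGATE to
`(γ_H)_v`**: the first coordinate is `K₂,v`-conjugate to `(γ₂)_v` (hypothesis `hPv`, the place-`v` body of ★ `AdelicStableOrbitalSupportFiniteH`'s `hP`), the second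
EQUALS `(γ₁)_v` (★ `eq_of_isStablyConj_fin_one`). [cite: Rogawski1990, §3.3 p. 21] [cite: Kottwitz1986, Prop. 7.1] -/
theorem eq_mk_rationalComponent_of_isLocalStablyConjH_of_mem (v : HeightOneSpectrum (𝓞 ↥(maximalRealSubfield L)))
    (hPv : ∀ g : (UnitaryGroup.cmDatum L 2 (Matrix.of fun i j : Fin 2 => if i.val + j.val + 1 = 2 then (1 : L) else 0)).Local v,
      g ∈ UnitaryGroup.cmLocalIntegralLevel L 2 (Matrix.of fun i j : Fin 2 => if i.val + j.val + 1 = 2 then (1 : L) else 0) v →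
        IsStablyConj (UnitaryGroup.conjLocal L (IsCMField.complexConj L) v) ((UnitaryGroup.adelicForm L 2 (Matrix.of fun i j : Fin 2 => if i.val + j.val + 1 = 2 then (1 : L) else 0)).map (UnitaryGroup.adeleToLocal L v))
            ((UnitaryGroup.cmDatum L 2 (Matrix.of fun i j : Fin 2 => if i.val + j.val + 1 = 2 then (1 : L) else 0)).toLocal v ((UnitaryGroup.cmDatum L 2 (Matrix.of fun i j : Fin 2 => if i.val + j.val + 1 = 2 then (1 : L) else 0)).toAdelic γH.1)) g →
          ∃ k ∈ UnitaryGroup.cmLocalIntegralLevel L 2 (Matrix.of fun i j : Fin 2 => if i.val + j.val + 1 = 2 then (1 : L) else 0) v,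
            k * (UnitaryGroup.cmDatum L 2 (Matrix.of fun i j : Fin 2 => if i.val + j.val + 1 = 2 then (1 : L) else 0)).toLocal v ((UnitaryGroup.cmDatum L 2 (Matrix.of fun i j : Fin 2 => if i.val + j.val + 1 = 2 then (1 : L) else 0)).toAdelic γH.1) * k⁻¹ = g)
    {h : (UnitaryGroup.cmDatum L 2 (Matrix.of fun i j : Fin 2 => if i.val + j.val + 1 = 2 then (1 : L) else 0)).Local v ×
      (UnitaryGroup.cmDatum L 1 (Matrix.of fun i j : Fin 1 => if i.val + j.val + 1 = 1 then (1 : L) else 0)).Local v}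
    (hst : IsLocalStablyConjH L v (rationalComponent L γH v) h)
    (hint : h.1 ∈ UnitaryGroup.cmLocalIntegralLevel L 2 (Matrix.of fun i j : Fin 2 => if i.val + j.val + 1 = 2 then (1 : L) else 0) v) :
    ConjClasses.mk h = ConjClasses.mk (rationalComponent L γH v) := by
  obtain ⟨a, b⟩ := h
  obtain ⟨k, -, hk⟩ := hPv a hint hst.1
  have hb : b = (rationalComponent L γH v).2 := (eq_of_isStablyConj_fin_one hst.2).symm
  rw [ConjClasses.mk_eq_mk_iff_isConj]
  show IsConj (a, b)
    ((UnitaryGroup.cmDatum L 2 (Matrix.of fun i j : Fin 2 => if i.val + j.val + 1 = 2 then (1 : L) else 0)).toLocal v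
        ((UnitaryGroup.cmDatum L 2 (Matrix.of fun i j : Fin 2 => if i.val + j.val + 1 = 2 then (1 : L) else 0)).toAdelic γH.1),
      (UnitaryGroup.cmDatum L 1 (Matrix.of fun i j : Fin 1 => if i.val + j.val + 1 = 1 then (1 : L) else 0)).toLocal v
        ((UnitaryGroup.cmDatum L 1 (Matrix.of fun i j : Fin 1 => if i.val + j.val + 1 = 1 then (1 : L) else 0)).toAdelic γH.2))
  exact isConj_prod_of_isConj_of_eq' (isConj_iff.2 ⟨k, hk⟩).symm hb

/-- **At a good place, a stable class of `H_v` met by an element with `U(Φ₂)`-coordinate in `K₂,v` IS the base class `[(γ_H)_v]`** — the (h0) input «off `S` only the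
base class meets `K_{H,v}`» of the Σ–Π exchange. [cite: Rogawski1990, §4.3 p. 44] [cite: Kottwitz1986, Prop. 7.1, §7.3] -/
theorem eq_mk_rationalComponent_of_exists_mem (v : HeightOneSpectrum (𝓞 ↥(maximalRealSubfield L)))
    (hPv : ∀ g : (UnitaryGroup.cmDatum L 2 (Matrix.of fun i j : Fin 2 => if i.val + j.val + 1 = 2 then (1 : L) else 0)).Local v,
      g ∈ UnitaryGroup.cmLocalIntegralLevel L 2 (Matrix.of fun i j : Fin 2 => if i.val + j.val + 1 = 2 then (1 : L) else 0) v →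
        IsStablyConj (UnitaryGroup.conjLocal L (IsCMField.complexConj L) v) ((UnitaryGroup.adelicForm L 2 (Matrix.of fun i j : Fin 2 => if i.val + j.val + 1 = 2 then (1 : L) else 0)).map (UnitaryGroup.adeleToLocal L v))
            ((UnitaryGroup.cmDatum L 2 (Matrix.of fun i j : Fin 2 => if i.val + j.val + 1 = 2 then (1 : L) else 0)).toLocal v ((UnitaryGroup.cmDatum L 2 (Matrix.of fun i j : Fin 2 => if i.val + j.val + 1 = 2 then (1 : L) else 0)).toAdelic γH.1)) g →
          ∃ k ∈ UnitaryGroup.cmLocalIntegralLevel L 2 (Matrix.of fun i j : Fin 2 => if i.val + j.val + 1 = 2 then (1 : L) else 0) v,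
            k * (UnitaryGroup.cmDatum L 2 (Matrix.of fun i j : Fin 2 => if i.val + j.val + 1 = 2 then (1 : L) else 0)).toLocal v ((UnitaryGroup.cmDatum L 2 (Matrix.of fun i j : Fin 2 => if i.val + j.val + 1 = 2 then (1 : L) else 0)).toAdelic γH.1) * k⁻¹ = g)
    {d : ConjClasses ((UnitaryGroup.cmDatum L 2 (Matrix.of fun i j : Fin 2 => if i.val + j.val + 1 = 2 then (1 : L) else 0)).Local v ×
      (UnitaryGroup.cmDatum L 1 (Matrix.of fun i j : Fin 1 => if i.val + j.val + 1 = 1 then (1 : L) else 0)).Local v)}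
    (hd : IsLocalStablyConjH L v (rationalComponent L γH v) (Quotient.out d))
    (hh : ∃ h : (UnitaryGroup.cmDatum L 2 (Matrix.of fun i j : Fin 2 => if i.val + j.val + 1 = 2 then (1 : L) else 0)).Local v ×
        (UnitaryGroup.cmDatum L 1 (Matrix.of fun i j : Fin 1 => if i.val + j.val + 1 = 1 then (1 : L) else 0)).Local v,
      ConjClasses.mk h = d ∧ h.1 ∈ UnitaryGroup.cmLocalIntegralLevel L 2 (Matrix.of fun i j : Fin 2 => if i.val + j.val + 1 = 2 then (1 : L) else 0) v) :
    d = ConjClasses.mk (rationalComponent L γH v) := by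
  obtain ⟨h, rfl, hint⟩ := hh
  exact eq_mk_rationalComponent_of_isLocalStablyConjH_of_mem v hPv (hd.trans (isStablyConjH_of_isConj (isConj_out_conjClasses_mk'' h).symm)) hint

/-! ## §2 The Σ–Π exchange on `𝒞′_𝐀(γ_H)` for a summand factoring through the class maps -/

/-- **`∑ᶠ_{c ∈ 𝒞′_𝐀(γ_H)} Φ c = (∑ᶠ_{b ∈ St_∞} φ_∞ b) · ∏_{v ∈ S} ∑ᶠ_{d ∈ St_v} φ_v d`** for every summand `Φ` on the `H(𝐀)`-classes which FACTORS on `𝒞′_𝐀(γ_H)` through the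
local and archimedean class maps as `Φ c = φ_∞ (π_∞ c) · ∏ᶠ_v φ_v (π_v c)`, provided the finite set `S` contains the bad places of [Kt₄] Prop. 7.1 for `U(Φ₂)` at `γ₂`
(hypothesis `hPS`: its body at every `v ∉ S`), `φ_v [(γ_H)_v] = 1` off `S` (unit factors), `φ_v` vanishes off `S` at every stable class not met by an element with integral
`U(Φ₂)`-coordinate (so — §1 — at every stable class but the base one), and the supports of `φ_v` (`v ∈ S`) and `φ_∞` on the stable classes are finite.  Here
`St_v = {d | (γ_H)_v ∼_st out d}`, `St_∞ = {b | γ_H ⊗ 1 ∼_st out b}`.  (★ (E1) on the dictionary ★ (E2-H).) [cite: Rogawski1990, §4.3 p. 44; §5.4 pp. 72–73]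
[cite: Kottwitz1986, Prop. 7.1, §7.3] -/
theorem MatchingAdeleH.finsum_mem_classes_eq_finsum_mul_prod_finsum
    (S : Finset (HeightOneSpectrum (𝓞 ↥(maximalRealSubfield L))))
    (hPS : ∀ v ∉ S, ∀ g : (UnitaryGroup.cmDatum L 2 (Matrix.of fun i j : Fin 2 => if i.val + j.val + 1 = 2 then (1 : L) else 0)).Local v,
      g ∈ UnitaryGroup.cmLocalIntegralLevel L 2 (Matrix.of fun i j : Fin 2 => if i.val + j.val + 1 = 2 then (1 : L) else 0) v →
        IsStablyConj (UnitaryGroup.conjLocal L (IsCMField.complexConj L) v) ((UnitaryGroup.adelicForm L 2 (Matrix.of fun i j : Fin 2 => if i.val + j.val + 1 = 2 then (1 : L) else 0)).map (UnitaryGroup.adeleToLocal L v))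
            ((UnitaryGroup.cmDatum L 2 (Matrix.of fun i j : Fin 2 => if i.val + j.val + 1 = 2 then (1 : L) else 0)).toLocal v ((UnitaryGroup.cmDatum L 2 (Matrix.of fun i j : Fin 2 => if i.val + j.val + 1 = 2 then (1 : L) else 0)).toAdelic γH.1)) g →
          ∃ k ∈ UnitaryGroup.cmLocalIntegralLevel L 2 (Matrix.of fun i j : Fin 2 => if i.val + j.val + 1 = 2 then (1 : L) else 0) v,
            k * (UnitaryGroup.cmDatum L 2 (Matrix.of fun i j : Fin 2 => if i.val + j.val + 1 = 2 then (1 : L) else 0)).toLocal v ((UnitaryGroup.cmDatum L 2 (Matrix.of fun i j : Fin 2 => if i.val + j.val + 1 = 2 then (1 : L) else 0)).toAdelic γH.1) * k⁻¹ = g)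
    (Φ : ConjClasses ((UnitaryGroup.cmDatum L 2 (Matrix.of fun i j : Fin 2 => if i.val + j.val + 1 = 2 then (1 : L) else 0)).Adelic ×
      (UnitaryGroup.cmDatum L 1 (Matrix.of fun i j : Fin 1 => if i.val + j.val + 1 = 1 then (1 : L) else 0)).Adelic) → ℂ)
    (φ : ∀ v : HeightOneSpectrum (𝓞 ↥(maximalRealSubfield L)),
      ConjClasses ((UnitaryGroup.cmDatum L 2 (Matrix.of fun i j : Fin 2 => if i.val + j.val + 1 = 2 then (1 : L) else 0)).Local v ×
        (UnitaryGroup.cmDatum L 1 (Matrix.of fun i j : Fin 1 => if i.val + j.val + 1 = 1 then (1 : L) else 0)).Local v) → ℂ)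
    (φₐ : ConjClasses (↥(UnitaryGroup.arch (↥(maximalRealSubfield L)) L (IsCMField.complexConj L) 2
        (Matrix.of fun i j : Fin 2 => if i.val + j.val + 1 = 2 then (1 : L) else 0)) ×
      ↥(UnitaryGroup.arch (↥(maximalRealSubfield L)) L (IsCMField.complexConj L) 1
        (Matrix.of fun i j : Fin 1 => if i.val + j.val + 1 = 1 then (1 : L) else 0))) → ℂ)
    (hfac : ∀ c ∈ adelicStableClassesOverH L γH,
      Φ c = φₐ (ConjClasses.map (MonoidHom.prodMap
          (UnitaryGroup.archPart (↥(maximalRealSubfield L)) L (IsCMField.complexConj L) 2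
            (Matrix.of fun i j : Fin 2 => if i.val + j.val + 1 = 2 then (1 : L) else 0))
          (UnitaryGroup.archPart (↥(maximalRealSubfield L)) L (IsCMField.complexConj L) 1
            (Matrix.of fun i j : Fin 1 => if i.val + j.val + 1 = 1 then (1 : L) else 0))) c) *
        ∏ᶠ v, φ v (ConjClasses.map (MonoidHom.prodMap
          ((UnitaryGroup.cmDatum L 2 (Matrix.of fun i j : Fin 2 => if i.val + j.val + 1 = 2 then (1 : L) else 0)).toLocal v)
          ((UnitaryGroup.cmDatum L 1 (Matrix.of fun i j : Fin 1 => if i.val + j.val + 1 = 1 then (1 : L) else 0)).toLocal v)) c))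
    (h1 : ∀ v ∉ S, φ v (ConjClasses.mk (rationalComponent L γH v)) = 1)
    (h0 : ∀ v ∉ S, ∀ d, IsLocalStablyConjH L v (rationalComponent L γH v) (Quotient.out d) → φ v d ≠ 0 →
      ∃ h : (UnitaryGroup.cmDatum L 2 (Matrix.of fun i j : Fin 2 => if i.val + j.val + 1 = 2 then (1 : L) else 0)).Local v ×
          (UnitaryGroup.cmDatum L 1 (Matrix.of fun i j : Fin 1 => if i.val + j.val + 1 = 1 then (1 : L) else 0)).Local v,
        ConjClasses.mk h = d ∧ h.1 ∈ UnitaryGroup.cmLocalIntegralLevel L 2 (Matrix.of fun i j : Fin 2 => if i.val + j.val + 1 = 2 then (1 : L) else 0) v)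
    (hfin : ∀ v ∈ S, (support (φ v) ∩ {d | IsLocalStablyConjH L v (rationalComponent L γH v) (Quotient.out d)}).Finite)
    (hfinₐ : (support φₐ ∩ {b | IsArchStablyConjH L (rationalArch L γH) (Quotient.out b)}).Finite) :
    ∑ᶠ c ∈ adelicStableClassesOverH L γH, Φ c =
      (∑ᶠ b ∈ {b | IsArchStablyConjH L (rationalArch L γH) (Quotient.out b)}, φₐ b) *
        ∏ v ∈ S, ∑ᶠ d ∈ {d | IsLocalStablyConjH L v (rationalComponent L γH v) (Quotient.out d)}, φ v d := by
  -- the bad places of `hP` lie in `S`, so `hP` holds in its `∀ᶠ` form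
  have hP : ∀ᶠ v in cofinite, ∀ g : (UnitaryGroup.cmDatum L 2 (Matrix.of fun i j : Fin 2 => if i.val + j.val + 1 = 2 then (1 : L) else 0)).Local v,
      g ∈ UnitaryGroup.cmLocalIntegralLevel L 2 (Matrix.of fun i j : Fin 2 => if i.val + j.val + 1 = 2 then (1 : L) else 0) v →
        IsStablyConj (UnitaryGroup.conjLocal L (IsCMField.complexConj L) v) ((UnitaryGroup.adelicForm L 2 (Matrix.of fun i j : Fin 2 => if i.val + j.val + 1 = 2 then (1 : L) else 0)).map (UnitaryGroup.adeleToLocal L v))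
            ((UnitaryGroup.cmDatum L 2 (Matrix.of fun i j : Fin 2 => if i.val + j.val + 1 = 2 then (1 : L) else 0)).toLocal v ((UnitaryGroup.cmDatum L 2 (Matrix.of fun i j : Fin 2 => if i.val + j.val + 1 = 2 then (1 : L) else 0)).toAdelic γH.1)) g →
          ∃ k ∈ UnitaryGroup.cmLocalIntegralLevel L 2 (Matrix.of fun i j : Fin 2 => if i.val + j.val + 1 = 2 then (1 : L) else 0) v,
            k * (UnitaryGroup.cmDatum L 2 (Matrix.of fun i j : Fin 2 => if i.val + j.val + 1 = 2 then (1 : L) else 0)).toLocal v ((UnitaryGroup.cmDatum L 2 (Matrix.of fun i j : Fin 2 => if i.val + j.val + 1 = 2 then (1 : L) else 0)).toAdelic γH.1) * k⁻¹ = g := by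
    filter_upwards [S.finite_toSet.compl_mem_cofinite] with v hv
    exact hPS v (fun h => hv (Finset.mem_coe.2 h))
  refine finsum_mem_eq_finsum_mul_prod_finsum_of_factor (adelicStableClassesOverH L γH)
    (fun c v => ConjClasses.map (MonoidHom.prodMap
      ((UnitaryGroup.cmDatum L 2 (Matrix.of fun i j : Fin 2 => if i.val + j.val + 1 = 2 then (1 : L) else 0)).toLocal v)
      ((UnitaryGroup.cmDatum L 1 (Matrix.of fun i j : Fin 1 => if i.val + j.val + 1 = 1 then (1 : L) else 0)).toLocal v)) c)
    (fun c => ConjClasses.map (MonoidHom.prodMap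
      (UnitaryGroup.archPart (↥(maximalRealSubfield L)) L (IsCMField.complexConj L) 2
        (Matrix.of fun i j : Fin 2 => if i.val + j.val + 1 = 2 then (1 : L) else 0))
      (UnitaryGroup.archPart (↥(maximalRealSubfield L)) L (IsCMField.complexConj L) 1
        (Matrix.of fun i j : Fin 1 => if i.val + j.val + 1 = 1 then (1 : L) else 0))) c)
    (fun v => {d | IsLocalStablyConjH L v (rationalComponent L γH v) (Quotient.out d)}) (fun v => ConjClasses.mk (rationalComponent L γH v))
    {b | IsArchStablyConjH L (rationalArch L γH) (Quotient.out b)} Φ φ φₐ S ?_ ?_ ?_ ?_ ?_ hfac h1 ?_ hfin hfinₐ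
  · -- (he) the base class is in the stable class
    exact fun v => isStablyConjH_of_isConj (isConj_out_conjClasses_mk'' _)
  · -- (inj)
    intro c hc c' hc' heq
    have hπ := congrArg Prod.fst heq
    have ha := congrArg Prod.snd heq
    exact MatchingAdeleH.eq_of_forall_map_toLocal_eq_of_map_arch_eq hP hc hc' (fun v => congrFun hπ v) ha
  · -- (img)
    exact fun c hc => ⟨fun v => MatchingAdeleH.isLocalStablyConjH_out_map_toLocal hc v, MatchingAdeleH.isArchStablyConjH_out_map_arch hc⟩
  · -- (ev)
    exact fun c hc => MatchingAdeleH.eventually_map_toLocal_eq_mk hP hc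
  · -- (surj)
    intro δ b hδ hev hb
    obtain ⟨c, hc, hcv, hcb⟩ := MatchingAdeleH.exists_mem_classes_of_forall δ b hδ hev hb
    exact ⟨c, hc, funext hcv, hcb⟩
  · -- (h0) off `S` only the base class is met by an element with integral `U(Φ₂)`-coordinate
    intro v hv d hd hne
    by_contra hφ
    exact hne (eq_mk_rationalComponent_of_exists_mem v (hPS v hv) hd (h0 v hv d hd hφ))

/-! ## §3 The `H`-adelic stable orbital sum is Euler -/

variable [∀ h : (UnitaryGroup.cmDatum L 2 (Matrix.of fun i j : Fin 2 => if i.val + j.val + 1 = 2 then (1 : L) else 0)).Adelic ×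
    (UnitaryGroup.cmDatum L 1 (Matrix.of fun i j : Fin 1 => if i.val + j.val + 1 = 1 then (1 : L) else 0)).Adelic,
  MeasurableSpace (((UnitaryGroup.cmDatum L 2 (Matrix.of fun i j : Fin 2 => if i.val + j.val + 1 = 2 then (1 : L) else 0)).Adelic ×
    (UnitaryGroup.cmDatum L 1 (Matrix.of fun i j : Fin 1 => if i.val + j.val + 1 = 1 then (1 : L) else 0)).Adelic) ⧸
    Subgroup.centralizer ({h} : Set ((UnitaryGroup.cmDatum L 2 (Matrix.of fun i j : Fin 2 => if i.val + j.val + 1 = 2 then (1 : L) else 0)).Adelic ×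
      (UnitaryGroup.cmDatum L 1 (Matrix.of fun i j : Fin 1 => if i.val + j.val + 1 = 1 then (1 : L) else 0)).Adelic)))]

/-- **THE `H`-SIDE EULER DISCHARGE — `Σ_{δ ∈ 𝒞′_𝐀(γ_H)} Φ_{m_𝐀}(δ, f^H) = Φ^st_{H,∞} · ∏_{v ∈ S} Φ^st_{H,v}` as ★ `IsEulerOnClasses`**, for EVERY class-indexed orbital measure family
`m_𝐀` on `H(𝐀) = U(Φ₂)(𝔸) × U(Φ₁)(𝔸)` and every `f^H`, GIVEN that the class orbital integrals `Φ_{m_𝐀}(c, f^H)` factor on `𝒞′_𝐀(γ_H)` through the local and archimedean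
classes (`hfac` — the Euler product of an adelic family built from local families on a pure tensor), with unit local factors at the base classes off `S` (`h1` — `K_{H,v}`-unit
factors), vanishing off `S` at stable classes not met by an element with integral `U(Φ₂)`-coordinate (`h0` — support in `K_{H,v}`), finite supports on the stable classes
(`hfin`, `hfinₐ`), and `S` containing the bad places of [Kt₄] Prop. 7.1 for `U(Φ₂)` at `γ₂` (`hPS`): then
`IsEulerOnClasses (𝒞′_𝐀(γ_H)) m_𝐀 f^H S (fun v => ∑ᶠ d ∈ St_v, φ_v d) (∑ᶠ b ∈ St_∞, φ_∞ b)` — the local ∕ archimedean stable orbital sums of `H` as the Euler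
factors («we may therefore set `Φ^κ(γ, f) = Π_v Φ^{κ_v}(γ, f_v)`»). [cite: Rogawski1990, §4.3 p. 44; §5.4 (5.4.3) pp. 72–73] [cite: Kottwitz1986, Prop. 7.1, §7.3] -/
theorem MatchingAdeleH.isEulerOnClasses_of_factor
    (mA : OrbitalMeasureFamily ((UnitaryGroup.cmDatum L 2 (Matrix.of fun i j : Fin 2 => if i.val + j.val + 1 = 2 then (1 : L) else 0)).Adelic ×
      (UnitaryGroup.cmDatum L 1 (Matrix.of fun i j : Fin 1 => if i.val + j.val + 1 = 1 then (1 : L) else 0)).Adelic))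
    (fH : (UnitaryGroup.cmDatum L 2 (Matrix.of fun i j : Fin 2 => if i.val + j.val + 1 = 2 then (1 : L) else 0)).Adelic ×
      (UnitaryGroup.cmDatum L 1 (Matrix.of fun i j : Fin 1 => if i.val + j.val + 1 = 1 then (1 : L) else 0)).Adelic → ℂ)
    (S : Finset (HeightOneSpectrum (𝓞 ↥(maximalRealSubfield L))))
    (hPS : ∀ v ∉ S, ∀ g : (UnitaryGroup.cmDatum L 2 (Matrix.of fun i j : Fin 2 => if i.val + j.val + 1 = 2 then (1 : L) else 0)).Local v,
      g ∈ UnitaryGroup.cmLocalIntegralLevel L 2 (Matrix.of fun i j : Fin 2 => if i.val + j.val + 1 = 2 then (1 : L) else 0) v →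
        IsStablyConj (UnitaryGroup.conjLocal L (IsCMField.complexConj L) v) ((UnitaryGroup.adelicForm L 2 (Matrix.of fun i j : Fin 2 => if i.val + j.val + 1 = 2 then (1 : L) else 0)).map (UnitaryGroup.adeleToLocal L v))
            ((UnitaryGroup.cmDatum L 2 (Matrix.of fun i j : Fin 2 => if i.val + j.val + 1 = 2 then (1 : L) else 0)).toLocal v ((UnitaryGroup.cmDatum L 2 (Matrix.of fun i j : Fin 2 => if i.val + j.val + 1 = 2 then (1 : L) else 0)).toAdelic γH.1)) g →
          ∃ k ∈ UnitaryGroup.cmLocalIntegralLevel L 2 (Matrix.of fun i j : Fin 2 => if i.val + j.val + 1 = 2 then (1 : L) else 0) v,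
            k * (UnitaryGroup.cmDatum L 2 (Matrix.of fun i j : Fin 2 => if i.val + j.val + 1 = 2 then (1 : L) else 0)).toLocal v ((UnitaryGroup.cmDatum L 2 (Matrix.of fun i j : Fin 2 => if i.val + j.val + 1 = 2 then (1 : L) else 0)).toAdelic γH.1) * k⁻¹ = g)
    (φ : ∀ v : HeightOneSpectrum (𝓞 ↥(maximalRealSubfield L)),
      ConjClasses ((UnitaryGroup.cmDatum L 2 (Matrix.of fun i j : Fin 2 => if i.val + j.val + 1 = 2 then (1 : L) else 0)).Local v ×
        (UnitaryGroup.cmDatum L 1 (Matrix.of fun i j : Fin 1 => if i.val + j.val + 1 = 1 then (1 : L) else 0)).Local v) → ℂ)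
    (φₐ : ConjClasses (↥(UnitaryGroup.arch (↥(maximalRealSubfield L)) L (IsCMField.complexConj L) 2
        (Matrix.of fun i j : Fin 2 => if i.val + j.val + 1 = 2 then (1 : L) else 0)) ×
      ↥(UnitaryGroup.arch (↥(maximalRealSubfield L)) L (IsCMField.complexConj L) 1
        (Matrix.of fun i j : Fin 1 => if i.val + j.val + 1 = 1 then (1 : L) else 0))) → ℂ)
    (hfac : ∀ c ∈ adelicStableClassesOverH L γH,
      classOrbitalIntegral mA fH c = φₐ (ConjClasses.map (MonoidHom.prodMap
          (UnitaryGroup.archPart (↥(maximalRealSubfield L)) L (IsCMField.complexConj L) 2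
            (Matrix.of fun i j : Fin 2 => if i.val + j.val + 1 = 2 then (1 : L) else 0))
          (UnitaryGroup.archPart (↥(maximalRealSubfield L)) L (IsCMField.complexConj L) 1
            (Matrix.of fun i j : Fin 1 => if i.val + j.val + 1 = 1 then (1 : L) else 0))) c) *
        ∏ᶠ v, φ v (ConjClasses.map (MonoidHom.prodMap
          ((UnitaryGroup.cmDatum L 2 (Matrix.of fun i j : Fin 2 => if i.val + j.val + 1 = 2 then (1 : L) else 0)).toLocal v)
          ((UnitaryGroup.cmDatum L 1 (Matrix.of fun i j : Fin 1 => if i.val + j.val + 1 = 1 then (1 : L) else 0)).toLocal v)) c))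
    (h1 : ∀ v ∉ S, φ v (ConjClasses.mk (rationalComponent L γH v)) = 1)
    (h0 : ∀ v ∉ S, ∀ d, IsLocalStablyConjH L v (rationalComponent L γH v) (Quotient.out d) → φ v d ≠ 0 →
      ∃ h : (UnitaryGroup.cmDatum L 2 (Matrix.of fun i j : Fin 2 => if i.val + j.val + 1 = 2 then (1 : L) else 0)).Local v ×
          (UnitaryGroup.cmDatum L 1 (Matrix.of fun i j : Fin 1 => if i.val + j.val + 1 = 1 then (1 : L) else 0)).Local v,
        ConjClasses.mk h = d ∧ h.1 ∈ UnitaryGroup.cmLocalIntegralLevel L 2 (Matrix.of fun i j : Fin 2 => if i.val + j.val + 1 = 2 then (1 : L) else 0) v)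
    (hfin : ∀ v ∈ S, (support (φ v) ∩ {d | IsLocalStablyConjH L v (rationalComponent L γH v) (Quotient.out d)}).Finite)
    (hfinₐ : (support φₐ ∩ {b | IsArchStablyConjH L (rationalArch L γH) (Quotient.out b)}).Finite) :
    IsEulerOnClasses (adelicStableClassesOverH L γH) mA fH S
      (fun v => ∑ᶠ d ∈ {d | IsLocalStablyConjH L v (rationalComponent L γH v) (Quotient.out d)}, φ v d)
      (∑ᶠ b ∈ {b | IsArchStablyConjH L (rationalArch L γH) (Quotient.out b)}, φₐ b) := by
  rw [isEulerOnClasses_iff, adelicStableOrbitalSum_def]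
  exact MatchingAdeleH.finsum_mem_classes_eq_finsum_mul_prod_finsum S hPS (classOrbitalIntegral mA fH) φ φₐ hfac h1 h0 hfin hfinₐ

/-- **`Φ^st_H(γ_H, f^H)` in closed Euler form**: under the same hypotheses, ★ `adelicStableOrbitalIntegralH L γH m_𝐀 f^H = (∑ᶠ_{b ∈ St_∞} φ_∞ b) · ∏_{v ∈ S} ∑ᶠ_{d ∈ St_v} φ_v d`.
[cite: Rogawski1990, §5.4 Prop. 5.4.1 p. 72; §4.3 p. 44] -/
theorem MatchingAdeleH.adelicStableOrbitalIntegralH_eq_finsum_mul_prod_of_factor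
    (mA : OrbitalMeasureFamily ((UnitaryGroup.cmDatum L 2 (Matrix.of fun i j : Fin 2 => if i.val + j.val + 1 = 2 then (1 : L) else 0)).Adelic ×
      (UnitaryGroup.cmDatum L 1 (Matrix.of fun i j : Fin 1 => if i.val + j.val + 1 = 1 then (1 : L) else 0)).Adelic))
    (fH : (UnitaryGroup.cmDatum L 2 (Matrix.of fun i j : Fin 2 => if i.val + j.val + 1 = 2 then (1 : L) else 0)).Adelic ×
      (UnitaryGroup.cmDatum L 1 (Matrix.of fun i j : Fin 1 => if i.val + j.val + 1 = 1 then (1 : L) else 0)).Adelic → ℂ)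
    (S : Finset (HeightOneSpectrum (𝓞 ↥(maximalRealSubfield L))))
    (hPS : ∀ v ∉ S, ∀ g : (UnitaryGroup.cmDatum L 2 (Matrix.of fun i j : Fin 2 => if i.val + j.val + 1 = 2 then (1 : L) else 0)).Local v,
      g ∈ UnitaryGroup.cmLocalIntegralLevel L 2 (Matrix.of fun i j : Fin 2 => if i.val + j.val + 1 = 2 then (1 : L) else 0) v →
        IsStablyConj (UnitaryGroup.conjLocal L (IsCMField.complexConj L) v) ((UnitaryGroup.adelicForm L 2 (Matrix.of fun i j : Fin 2 => if i.val + j.val + 1 = 2 then (1 : L) else 0)).map (UnitaryGroup.adeleToLocal L v))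
            ((UnitaryGroup.cmDatum L 2 (Matrix.of fun i j : Fin 2 => if i.val + j.val + 1 = 2 then (1 : L) else 0)).toLocal v ((UnitaryGroup.cmDatum L 2 (Matrix.of fun i j : Fin 2 => if i.val + j.val + 1 = 2 then (1 : L) else 0)).toAdelic γH.1)) g →
          ∃ k ∈ UnitaryGroup.cmLocalIntegralLevel L 2 (Matrix.of fun i j : Fin 2 => if i.val + j.val + 1 = 2 then (1 : L) else 0) v,
            k * (UnitaryGroup.cmDatum L 2 (Matrix.of fun i j : Fin 2 => if i.val + j.val + 1 = 2 then (1 : L) else 0)).toLocal v ((UnitaryGroup.cmDatum L 2 (Matrix.of fun i j : Fin 2 => if i.val + j.val + 1 = 2 then (1 : L) else 0)).toAdelic γH.1) * k⁻¹ = g)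
    (φ : ∀ v : HeightOneSpectrum (𝓞 ↥(maximalRealSubfield L)),
      ConjClasses ((UnitaryGroup.cmDatum L 2 (Matrix.of fun i j : Fin 2 => if i.val + j.val + 1 = 2 then (1 : L) else 0)).Local v ×
        (UnitaryGroup.cmDatum L 1 (Matrix.of fun i j : Fin 1 => if i.val + j.val + 1 = 1 then (1 : L) else 0)).Local v) → ℂ)
    (φₐ : ConjClasses (↥(UnitaryGroup.arch (↥(maximalRealSubfield L)) L (IsCMField.complexConj L) 2
        (Matrix.of fun i j : Fin 2 => if i.val + j.val + 1 = 2 then (1 : L) else 0)) ×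
      ↥(UnitaryGroup.arch (↥(maximalRealSubfield L)) L (IsCMField.complexConj L) 1
        (Matrix.of fun i j : Fin 1 => if i.val + j.val + 1 = 1 then (1 : L) else 0))) → ℂ)
    (hfac : ∀ c ∈ adelicStableClassesOverH L γH,
      classOrbitalIntegral mA fH c = φₐ (ConjClasses.map (MonoidHom.prodMap
          (UnitaryGroup.archPart (↥(maximalRealSubfield L)) L (IsCMField.complexConj L) 2
            (Matrix.of fun i j : Fin 2 => if i.val + j.val + 1 = 2 then (1 : L) else 0))
          (UnitaryGroup.archPart (↥(maximalRealSubfield L)) L (IsCMField.complexConj L) 1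
            (Matrix.of fun i j : Fin 1 => if i.val + j.val + 1 = 1 then (1 : L) else 0))) c) *
        ∏ᶠ v, φ v (ConjClasses.map (MonoidHom.prodMap
          ((UnitaryGroup.cmDatum L 2 (Matrix.of fun i j : Fin 2 => if i.val + j.val + 1 = 2 then (1 : L) else 0)).toLocal v)
          ((UnitaryGroup.cmDatum L 1 (Matrix.of fun i j : Fin 1 => if i.val + j.val + 1 = 1 then (1 : L) else 0)).toLocal v)) c))
    (h1 : ∀ v ∉ S, φ v (ConjClasses.mk (rationalComponent L γH v)) = 1)
    (h0 : ∀ v ∉ S, ∀ d, IsLocalStablyConjH L v (rationalComponent L γH v) (Quotient.out d) → φ v d ≠ 0 →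
      ∃ h : (UnitaryGroup.cmDatum L 2 (Matrix.of fun i j : Fin 2 => if i.val + j.val + 1 = 2 then (1 : L) else 0)).Local v ×
          (UnitaryGroup.cmDatum L 1 (Matrix.of fun i j : Fin 1 => if i.val + j.val + 1 = 1 then (1 : L) else 0)).Local v,
        ConjClasses.mk h = d ∧ h.1 ∈ UnitaryGroup.cmLocalIntegralLevel L 2 (Matrix.of fun i j : Fin 2 => if i.val + j.val + 1 = 2 then (1 : L) else 0) v)
    (hfin : ∀ v ∈ S, (support (φ v) ∩ {d | IsLocalStablyConjH L v (rationalComponent L γH v) (Quotient.out d)}).Finite)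
    (hfinₐ : (support φₐ ∩ {b | IsArchStablyConjH L (rationalArch L γH) (Quotient.out b)}).Finite) :
    adelicStableOrbitalIntegralH L γH mA fH =
      (∑ᶠ b ∈ {b | IsArchStablyConjH L (rationalArch L γH) (Quotient.out b)}, φₐ b) *
        ∏ v ∈ S, ∑ᶠ d ∈ {d | IsLocalStablyConjH L v (rationalComponent L γH v) (Quotient.out d)}, φ v d := by
  rw [adelicStableOrbitalIntegralH_def]
  exact MatchingAdeleH.finsum_mem_classes_eq_finsum_mul_prod_finsum S hPS (classOrbitalIntegral mA fH) φ φₐ hfac h1 h0 hfin hfinₐ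

/-! ## §4 The Euler factors READ as the local ∕ archimedean stable orbital integrals of `H` -/

/-- `ConjClasses.map f c = [f (out c)]` (plumbing). [cite: Rogawski1990, §5.4 p. 72] -/
private theorem conjClasses_map_eq_mk_out'' {A B : Type*} [Monoid A] [Monoid B] (f : A →* B) (c : ConjClasses A) :
    ConjClasses.map f c = ConjClasses.mk (f (Quotient.out c)) := by
  conv_lhs => rw [← conjClasses_mk_out_eq'' c]
  rfl

variable
  [∀ (v : HeightOneSpectrum (𝓞 ↥(maximalRealSubfield L))) (a : ((UnitaryGroup.cmDatum L 2 (Matrix.of fun i j : Fin 2 => if i.val + j.val + 1 = 2 then (1 : L) else 0)).Local v ×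
        (UnitaryGroup.cmDatum L 1 (Matrix.of fun i j : Fin 1 => if i.val + j.val + 1 = 1 then (1 : L) else 0)).Local v)),
    MeasurableSpace (((UnitaryGroup.cmDatum L 2 (Matrix.of fun i j : Fin 2 => if i.val + j.val + 1 = 2 then (1 : L) else 0)).Local v ×
        (UnitaryGroup.cmDatum L 1 (Matrix.of fun i j : Fin 1 => if i.val + j.val + 1 = 1 then (1 : L) else 0)).Local v) ⧸ Subgroup.centralizer ({a} : Set ((UnitaryGroup.cmDatum L 2 (Matrix.of fun i j : Fin 2 => if i.val + j.val + 1 = 2 then (1 : L) else 0)).Local v ×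
        (UnitaryGroup.cmDatum L 1 (Matrix.of fun i j : Fin 1 => if i.val + j.val + 1 = 1 then (1 : L) else 0)).Local v)))]
  [∀ a : (↥(UnitaryGroup.arch (↥(maximalRealSubfield L)) L (IsCMField.complexConj L) 2
        (Matrix.of fun i j : Fin 2 => if i.val + j.val + 1 = 2 then (1 : L) else 0)) ×
      ↥(UnitaryGroup.arch (↥(maximalRealSubfield L)) L (IsCMField.complexConj L) 1
        (Matrix.of fun i j : Fin 1 => if i.val + j.val + 1 = 1 then (1 : L) else 0))), MeasurableSpace ((↥(UnitaryGroup.arch (↥(maximalRealSubfield L)) L (IsCMField.complexConj L) 2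
        (Matrix.of fun i j : Fin 2 => if i.val + j.val + 1 = 2 then (1 : L) else 0)) ×
      ↥(UnitaryGroup.arch (↥(maximalRealSubfield L)) L (IsCMField.complexConj L) 1
        (Matrix.of fun i j : Fin 1 => if i.val + j.val + 1 = 1 then (1 : L) else 0))) ⧸ Subgroup.centralizer ({a} : Set (↥(UnitaryGroup.arch (↥(maximalRealSubfield L)) L (IsCMField.complexConj L) 2
        (Matrix.of fun i j : Fin 2 => if i.val + j.val + 1 = 2 then (1 : L) else 0)) ×
      ↥(UnitaryGroup.arch (↥(maximalRealSubfield L)) L (IsCMField.complexConj L) 1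
        (Matrix.of fun i j : Fin 1 => if i.val + j.val + 1 = 1 then (1 : L) else 0)))))]

/-- **`IsEulerOnClasses` for the `H`-side with the Euler factors READ AS THE LOCAL ∕ ARCHIMEDEAN STABLE ORBITAL INTEGRALS OF `H`** — the shape the 1.19c
SJ_H socket consumes.  With local families `mloc v` and test factors `floc v` on `H_v`, an archimedean family `marc` and factor `farc`: if on `𝒞′_𝐀(γ_H)` the
class orbital integrals factor IN THE FINITE-SET SHAPE an adelic family built from local families delivers («C-H»: per class `c` a finite `S₂` with unit local
factors off it and `Φ_m(c, f^H) = Φ_{marc}([c_∞], farc) · ∏_{v ∈ S₂} Φ_{mloc v}([c_v], floc v)`), the base class has unit factor off `S` («S-H», ★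
`exists_finset_forall_classOrbitalIntegral_loc_rationalComponent_eq_one`-shape), a non-zero factor off `S` is only met through an element with integral
`U(Φ₂)`-coordinate (support of `floc v` in `K_{H,v}`), finite supports on the stable classes at `v ∈ S` and `∞`, and `S` contains the bad places of [Kt₄] 7.1 for
`U(Φ₂)` at `γ₂` (`hPS`), then ★ `IsEulerOnClasses (adelicStableClassesOverH L γH) m f^H S (v ↦ Φ^st_{H,v}((γ_H)_v, floc v; mloc v)) (Φ^st_{H,∞}(γ_H ⊗ 1, farc; marc))`
with `Φ^st_{H,v} = stableOrbitalIntegralRel (IsLocalStablyConjH L v)` and `Φ^st_{H,∞} = stableOrbitalIntegralRel (IsArchStablyConjH L)` — the `H`-side stable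
orbital integrals EXACTLY as ★ `IsLocalDeltaTransfer` ∕ ★ `IsArchDeltaTransfer` spell them. [cite: Rogawski1990, §4.3 p. 44; §5.4 (5.4.3) pp. 72–73]
[cite: Kottwitz1986, Prop. 7.1, §7.3] -/
theorem MatchingAdeleH.isEulerOnClasses_of_factor_finset
    (mA : OrbitalMeasureFamily ((UnitaryGroup.cmDatum L 2 (Matrix.of fun i j : Fin 2 => if i.val + j.val + 1 = 2 then (1 : L) else 0)).Adelic ×
      (UnitaryGroup.cmDatum L 1 (Matrix.of fun i j : Fin 1 => if i.val + j.val + 1 = 1 then (1 : L) else 0)).Adelic))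
    (fH : (UnitaryGroup.cmDatum L 2 (Matrix.of fun i j : Fin 2 => if i.val + j.val + 1 = 2 then (1 : L) else 0)).Adelic ×
      (UnitaryGroup.cmDatum L 1 (Matrix.of fun i j : Fin 1 => if i.val + j.val + 1 = 1 then (1 : L) else 0)).Adelic → ℂ)
    (mloc : ∀ v : HeightOneSpectrum (𝓞 ↥(maximalRealSubfield L)), OrbitalMeasureFamily ((UnitaryGroup.cmDatum L 2 (Matrix.of fun i j : Fin 2 => if i.val + j.val + 1 = 2 then (1 : L) else 0)).Local v ×
        (UnitaryGroup.cmDatum L 1 (Matrix.of fun i j : Fin 1 => if i.val + j.val + 1 = 1 then (1 : L) else 0)).Local v))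
    (floc : ∀ v : HeightOneSpectrum (𝓞 ↥(maximalRealSubfield L)), ((UnitaryGroup.cmDatum L 2 (Matrix.of fun i j : Fin 2 => if i.val + j.val + 1 = 2 then (1 : L) else 0)).Local v ×
        (UnitaryGroup.cmDatum L 1 (Matrix.of fun i j : Fin 1 => if i.val + j.val + 1 = 1 then (1 : L) else 0)).Local v) → ℂ)
    (marc : OrbitalMeasureFamily (↥(UnitaryGroup.arch (↥(maximalRealSubfield L)) L (IsCMField.complexConj L) 2
        (Matrix.of fun i j : Fin 2 => if i.val + j.val + 1 = 2 then (1 : L) else 0)) ×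
      ↥(UnitaryGroup.arch (↥(maximalRealSubfield L)) L (IsCMField.complexConj L) 1
        (Matrix.of fun i j : Fin 1 => if i.val + j.val + 1 = 1 then (1 : L) else 0))))
    (farc : (↥(UnitaryGroup.arch (↥(maximalRealSubfield L)) L (IsCMField.complexConj L) 2
        (Matrix.of fun i j : Fin 2 => if i.val + j.val + 1 = 2 then (1 : L) else 0)) ×
      ↥(UnitaryGroup.arch (↥(maximalRealSubfield L)) L (IsCMField.complexConj L) 1
        (Matrix.of fun i j : Fin 1 => if i.val + j.val + 1 = 1 then (1 : L) else 0))) → ℂ)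
    (S : Finset (HeightOneSpectrum (𝓞 ↥(maximalRealSubfield L))))
    (hPS : ∀ v ∉ S, ∀ g : (UnitaryGroup.cmDatum L 2 (Matrix.of fun i j : Fin 2 => if i.val + j.val + 1 = 2 then (1 : L) else 0)).Local v,
      g ∈ UnitaryGroup.cmLocalIntegralLevel L 2 (Matrix.of fun i j : Fin 2 => if i.val + j.val + 1 = 2 then (1 : L) else 0) v →
        IsStablyConj (UnitaryGroup.conjLocal L (IsCMField.complexConj L) v) ((UnitaryGroup.adelicForm L 2 (Matrix.of fun i j : Fin 2 => if i.val + j.val + 1 = 2 then (1 : L) else 0)).map (UnitaryGroup.adeleToLocal L v))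
            ((UnitaryGroup.cmDatum L 2 (Matrix.of fun i j : Fin 2 => if i.val + j.val + 1 = 2 then (1 : L) else 0)).toLocal v ((UnitaryGroup.cmDatum L 2 (Matrix.of fun i j : Fin 2 => if i.val + j.val + 1 = 2 then (1 : L) else 0)).toAdelic γH.1)) g →
          ∃ k ∈ UnitaryGroup.cmLocalIntegralLevel L 2 (Matrix.of fun i j : Fin 2 => if i.val + j.val + 1 = 2 then (1 : L) else 0) v,
            k * (UnitaryGroup.cmDatum L 2 (Matrix.of fun i j : Fin 2 => if i.val + j.val + 1 = 2 then (1 : L) else 0)).toLocal v ((UnitaryGroup.cmDatum L 2 (Matrix.of fun i j : Fin 2 => if i.val + j.val + 1 = 2 then (1 : L) else 0)).toAdelic γH.1) * k⁻¹ = g)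
    (hfac : ∀ c ∈ adelicStableClassesOverH L γH, ∃ S₂ : Finset (HeightOneSpectrum (𝓞 ↥(maximalRealSubfield L))),
      (∀ v ∉ S₂, classOrbitalIntegral (mloc v) (floc v) (ConjClasses.mk (MonoidHom.prodMap ((UnitaryGroup.cmDatum L 2 (Matrix.of fun i j : Fin 2 => if i.val + j.val + 1 = 2 then (1 : L) else 0)).toLocal v) ((UnitaryGroup.cmDatum L 1 (Matrix.of fun i j : Fin 1 => if i.val + j.val + 1 = 1 then (1 : L) else 0)).toLocal v) (Quotient.out c))) = 1) ∧
      classOrbitalIntegral mA fH c =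
        classOrbitalIntegral marc farc (ConjClasses.mk (MonoidHom.prodMap
          (UnitaryGroup.archPart (↥(maximalRealSubfield L)) L (IsCMField.complexConj L) 2
            (Matrix.of fun i j : Fin 2 => if i.val + j.val + 1 = 2 then (1 : L) else 0))
          (UnitaryGroup.archPart (↥(maximalRealSubfield L)) L (IsCMField.complexConj L) 1
            (Matrix.of fun i j : Fin 1 => if i.val + j.val + 1 = 1 then (1 : L) else 0)) (Quotient.out c))) *
        ∏ v ∈ S₂, classOrbitalIntegral (mloc v) (floc v) (ConjClasses.mk (MonoidHom.prodMap ((UnitaryGroup.cmDatum L 2 (Matrix.of fun i j : Fin 2 => if i.val + j.val + 1 = 2 then (1 : L) else 0)).toLocal v) ((UnitaryGroup.cmDatum L 1 (Matrix.of fun i j : Fin 1 => if i.val + j.val + 1 = 1 then (1 : L) else 0)).toLocal v) (Quotient.out c))))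
    (h1 : ∀ v ∉ S, classOrbitalIntegral (mloc v) (floc v) (ConjClasses.mk (rationalComponent L γH v)) = 1)
    (h0 : ∀ v ∉ S, ∀ d, IsLocalStablyConjH L v (rationalComponent L γH v) (Quotient.out d) → classOrbitalIntegral (mloc v) (floc v) d ≠ 0 →
      ∃ h : ((UnitaryGroup.cmDatum L 2 (Matrix.of fun i j : Fin 2 => if i.val + j.val + 1 = 2 then (1 : L) else 0)).Local v ×
        (UnitaryGroup.cmDatum L 1 (Matrix.of fun i j : Fin 1 => if i.val + j.val + 1 = 1 then (1 : L) else 0)).Local v),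
        ConjClasses.mk h = d ∧ h.1 ∈ UnitaryGroup.cmLocalIntegralLevel L 2 (Matrix.of fun i j : Fin 2 => if i.val + j.val + 1 = 2 then (1 : L) else 0) v)
    (hfin : ∀ v ∈ S, (support (classOrbitalIntegral (mloc v) (floc v)) ∩ {d | IsLocalStablyConjH L v (rationalComponent L γH v) (Quotient.out d)}).Finite)
    (hfinₐ : (support (classOrbitalIntegral marc farc) ∩ {b | IsArchStablyConjH L (rationalArch L γH) (Quotient.out b)}).Finite) :
    IsEulerOnClasses (adelicStableClassesOverH L γH) mA fH S
      (fun v => stableOrbitalIntegralRel (G := ((UnitaryGroup.cmDatum L 2 (Matrix.of fun i j : Fin 2 => if i.val + j.val + 1 = 2 then (1 : L) else 0)).Local v ×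
        (UnitaryGroup.cmDatum L 1 (Matrix.of fun i j : Fin 1 => if i.val + j.val + 1 = 1 then (1 : L) else 0)).Local v)) (IsLocalStablyConjH L v) (mloc v) (floc v) (rationalComponent L γH v))
      (stableOrbitalIntegralRel (G := (↥(UnitaryGroup.arch (↥(maximalRealSubfield L)) L (IsCMField.complexConj L) 2
        (Matrix.of fun i j : Fin 2 => if i.val + j.val + 1 = 2 then (1 : L) else 0)) ×
      ↥(UnitaryGroup.arch (↥(maximalRealSubfield L)) L (IsCMField.complexConj L) 1
        (Matrix.of fun i j : Fin 1 => if i.val + j.val + 1 = 1 then (1 : L) else 0)))) (IsArchStablyConjH L) marc farc (rationalArch L γH)) := by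
  rw [isEulerOnClasses_iff, adelicStableOrbitalSum_def]
  refine MatchingAdeleH.finsum_mem_classes_eq_finsum_mul_prod_finsum S hPS (classOrbitalIntegral mA fH)
    (fun v => classOrbitalIntegral (mloc v) (floc v)) (classOrbitalIntegral marc farc) (fun c hc => ?_) h1 h0 hfin hfinₐ
  obtain ⟨S₂, hS₂, hc'⟩ := hfac c hc
  rw [hc']
  simp only [conjClasses_map_eq_mk_out'']
  congr 1
  exact (finprod_eq_prod_of_mulSupport_subset _ fun v hv => Finset.mem_coe.2 (by by_contra h; exact hv (hS₂ v h))).symm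

end EulerH

end Literature.NumberTheory.Rogawski1990

end
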